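import Mathlib
import Literature.MathematicalPhysics.QuantumFieldTheory.MagnenRivasseauSeneor1993.MRS93CountertermFunctional
import HarnessLib

/-!
# Magnen–Rivasseau–Sénéor (CMP 155, 1993): THE ADJOINT REPRESENTATION ON THE PRINTED BASIS `t_a = iσ_a/2` —
# `Ad(g)_ab = −2Tr(t_a g t_b g⁻¹)`, `g(Σ_b X^b t_b)g⁻¹ = Σ_a (Ad(g)X)^a t_a`, and `Ad(g) ∈ SO(3)` for every unitary `g`,
# PROVED; whence the printed invariance sentences for CONSTANT gauge transformations quantified over `SU(2)` itself

statement-level skeleton of published definitions with citation tags; bookkeeping proved; nothing here is a claim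
about the Yang–Mills mass gap, about continuum Yang–Mills on `T⁴` without infrared cutoff, or about the Clay problem —
and nothing of Magnen–Rivasseau–Sénéor's analysis is asserted or formalised

**Citation header (reproduction of PUBLISHED work).** J. Magnen, V. Rivasseau, R. Sénéor, *Construction of YM₄ with
an infrared cutoff*, Commun. Math. Phys. **155** (1993) 325–383 [MagnenRivasseauSeneor1993], Sect. II.A p.328 tl.24–33
(the basis `t_a`, the trace form, the wedge product), p.329 tl.2–5 ((II.3), (II.4) «This action is invariant under the
gauge transformations»), Sect. III p.347 tl.19–22 («Our ultraviolet cutoff does not break global SU(2) … invariance»).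
Loci `p.NNN tl.nn` = journal page / text-layer line of the held scan `paper:magnen1993-cmp155-mrs-ym4-infrared-cutoff`
(PDF page = journal page − 324). Cell pub-balaban-gaps, track G3, seat mrs-lit-1 (gen 9); companion prose
`run/shared/lean/pub/pub-balaban-gaps/g3/MRS-AS-PRINTED.md` §2, §5. Builds on `…MRS93TruncatedGauge` (mrs-lit-2:
`Su2Conventions.pauli`, `tgen`, `toSu2`, `trace_tgen_mul`, `toSu2_commutator`) and `…MRS93CountertermFunctional` (gen 5:
`colourRotate`, `rotVec`, `coeff_colourRotate_vec`, `action_colourRotate`, `counterterm_colourRotate`,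
`ctFactor_colourRotate_of_mem_specialOrthogonalGroup`, `ops_invariant_of_mem_specialOrthogonalGroup`), used by name.

**Why this file.** Two G3 files state the global colour symmetry of MRS's cut-off theory and both leave the same
sentence in prose. Gen 5's `…MRS93CountertermFunctional` §4–§5 proves that the cut-off action (II.2), `F₄` and the four
new operators of (III.1) are invariant under `A ↦ R·A` for a REAL MATRIX `R` with `RᵀR = 1`, `det R = 1`, and SAYS (docstring
of `colourRotate`) «for `R ∈ SO(3)` the adjoint action of a constant `g ∈ SU(2)`, i.e. (II.4) with `∂_μ g = 0`». Gen 8's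
`…MRS93FiniteGaugeTransformations` types (II.4) in the matrix ring and SAYS (honest status) «The adjoint representation
`SU(2) → SO(3)` is not typed — the identities hold in all of `M₂(ℂ)`» / «the equivalent adjoint `SO(3)`-form on `ℝ³` is
not typed». This file types it and proves the dictionary, so that the two printed sentences — p.329 tl.4 «This action
is invariant under the gauge transformations» (for the constant ones) and p.347 tl.19–22 «Our ultraviolet cutoff does
not break global SU(2) … invariance» — are theorems quantified over the group element `g` the paper writes, not over
an abstract rotation `R`.

**What the paper prints (verbatim, from the page images).**
* p.328 tl.24–33: *«A = Σ_{a=1}^{3} A^a t_a, with t_a = (iσ_a/2), where the σ's are the three usual hermitian Pauli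
  matrices. With this convention the covariant derivative is D_μ = ∂_μ − λ[A_μ, ·]. We have Tr t_a t_b = −δ_ab/2. …
  Remark that in the three dimensional su(2) space, the commutator is a wedge product: [A^a_μ, A^b_ν] = ε^c_{ab}
  A^a_μ A^b_ν.»*
* p.329 tl.2–5: *«F² = F₂ + λF₃ + λ²F₄. (II.3) This action is invariant under the gauge transformations: A → A^g;
  (A^g)_μ = gA_μg⁻¹ + (1/λ) ∂_μg · g⁻¹. (II.4)»*; tl.6–7: *«In what follows these gauge transformations are limited to
  a particular topological sector, for instance the functions from the compact space to G.»*
* p.347 tl.19–25: *«Our ultraviolet cutoff does not break global SU(2) or Euclidean invariance (…). Therefore the only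
  new relevant or marginal operators that we should consider are −TrA_μA_μ, (−TrA_μA_μ)², (−TrA_μ(−Δ)A_μ) and
  −(Σ_μ ∂_μA_μ)² which we abbreviate respectively as A², A⁴, A(−Δ)A and (∂A)²».*

**What is typed here (definitions with bodies; everything else PROVED; zero `sorry`, zero named facts).**
* §1 COORDINATES ON THE PRINTED BASIS. `toSu2C v = Σ_a v_a t_a` for COMPLEX components `v ∈ ℂ³` (the tree's
  `toSu2` is the real case, `toSu2C_ofReal`; complex components are what the Fourier coefficients `Ã^a_μ(p)` of
  `…AxialYMAction.coeff` are), its closed form `toSu2C_eq`, additivity/homogeneity, `trace_toSu2C = 0`,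
  `toSu2C_single` (`e_b ↦ t_b`); the coordinate functional `coord M a = −2Tr(t_a M)` read off with the printed trace
  form («Tr t_a t_b = −δ_ab/2»: `trace_tgen_mul_toSu2C`, `coord_toSu2C`, `coord_toSu2`), **`toSu2C_injective`** (the
  `t_a` are linearly independent over `ℂ`), **`toSu2C_coord`** (they SPAN the traceless matrices: a traceless `M` is
  `Σ_a (−2Tr(t_aM)) t_a`), `coord_im_of_conjTranspose` (anti-Hermitian `M` ⇒ REAL coordinates — the compact form
  `su(2)`), the trace form `trace_toSu2C_mul_toSu2C` (`Tr(XY) = −½Σ_a X^aY^a`) and the wedge product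
  `toSu2C_commutator` (`[X, Y] = −Σ_c (X ×₃ Y)_c t_c`, Mathlib `crossProduct`; the sign precision of
  `Su2Conventions.toSu2_commutator` for the printed `t_a`, now over `ℂ`).
* §2 THE ADJOINT MATRIX `adC g : Matrix (Fin 3) (Fin 3) ℂ`, `(adC g)_ab = −2Tr(t_a g t_b g⁻¹)`, for any `g ∈ M₂(ℂ)`
  with `IsUnit (det g)`: **`conj_tgen`** (`g t_b g⁻¹ = Σ_a Ad(g)_ab t_a`), **`conj_toSu2C`** (`g(Σ_b v_b t_b)g⁻¹ =
  Σ_a (Ad(g)v)_a t_a` — (II.4) with `∂_μg = 0` acts on components by `Ad(g)`), `adC_one`, **`adC_mul`** (`Ad(gh) =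
  Ad(g)Ad(h)`), **`adC_transpose_mul_self`** (`Ad(g)ᵀAd(g) = 1`, from `Tr(gt_bg⁻¹·gt_cg⁻¹) = Tr(t_bt_c)`),
  `adC_mul_transpose_self`, **`adC_mulVec_cross`** (`Ad(g)(v ×₃ w) = Ad(g)v ×₃ Ad(g)w`, from `g[X,Y]g⁻¹ =
  [gXg⁻¹, gYg⁻¹]`) and **`det_adC`** (`det Ad(g) = 1` — PURE ALGEBRA, no connectedness and no square roots: the columns
  `c_b = Ad(g)e_b` satisfy `c_1 ×₃ c_2 = Ad(g)(e_1 ×₃ e_2) = c_0` and `c_0·c_0 = 1`, and `det = c_0·(c_1 ×₃ c_2)`).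
* §3 UNITARY `g` (`g ∈ Matrix.unitaryGroup (Fin 2) ℂ`, in particular `Matrix.specialUnitaryGroup` = `SU(2)`): `adC_im`
  (the entries are REAL, since `gt_bg⁻¹ = gt_bg†` is again anti-Hermitian), the real matrix **`ad g : Matrix (Fin 3)
  (Fin 3) ℝ`** (`ofReal_ad`, `adC_eq_map`), `ad_transpose_mul_self`, `det_ad`, **`ad_mem_specialOrthogonalGroup`**
  (`Ad(g) ∈ SO(3)` for every unitary `g`; `…_of_mem_specialUnitaryGroup`), `ad_one`, `ad_mul` (a homomorphism
  `U(2) → SO(3)`).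
* §4 THE DICTIONARY AND THE PRINTED SENTENCES OVER `g`: `rotVec_ad` (gen 5's `rotVec (ad g) v = adC g *ᵥ v`),
  **`conj_toSu2C_eq_rotVec`**, **`conj_toSu2`** (`g(Σ_aX^at_a)g⁻¹ = Σ_a(Ad(g)X)^at_a` for real components — (II.4) with
  `∂_μg = 0` AS PRINTED on `A_μ = Σ_a A^a_μ t_a`), **`toSu2C_coeff_colourRotate_ad`** (gen 5's `colourRotate (ad g)` IS
  conjugation by the constant `g` on every Fourier coefficient), and the corollaries **`action_colourRotate_ad`**
  (p.329 tl.4 for constant `g`: the cut-off action (II.2) is invariant under `A ↦ gAg⁻¹` for every unitary `g`),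
  **`counterterm_colourRotate_ad`** (p.347 tl.19–22: `CT_ρ` of (III.1) and `e^{CT_ρ}` of (II.78) likewise) and
  `ops_colourRotate_ad` (the four new operators one by one) — gen 5's theorems at `R = Ad(g)`.

**Readings (declared).** (M) as in `…FiniteGaugeTransformations`: fields are `M₂(ℂ)`-valued, `A_μ = Σ_a A^a_μ t_a`
with the PRINTED `t_a = iσ_a/2`; the wedge-product sign precision of `…TruncatedGauge` (`[X, Y] = −X ×₃ Y` on
coordinates for these `t_a`) is inherited, not re-adjudicated — it does not affect `Ad(g)`, which is defined by
conjugation. (U) The paper's `G = SU(2)`; everything in §3–§4 is proved for the larger `U(2)` (unitary `g`), through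
which `Ad` factors anyway (scalars act trivially), and specialised to Mathlib's `specialUnitaryGroup`. (K) Constant
`g` only: the inhomogeneous term `(1/λ)∂_μg·g⁻¹` of (II.4) vanishes for `∂_μg = 0` and is gen 8's business
(`FiniteGauge.gaugeAct`); this file does not import gen 8's module and restates nothing of it (its `trace_conj`,
`conj`-preserves-`su(2)` lemmas are used here only as one-line computations inside proofs).

**Honest status / what is NOT claimed.** Finite-dimensional matrix algebra of `su(2) ⊂ M₂(ℂ)` and its adjoint `SO(3)`:
no function space, no measure, no estimate; surjectivity of `U(2) → SO(3)` and its kernel are not needed and not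
typed; nothing of Sects. II.B–VIII moves. Nothing here is continuum Yang–Mills on `T⁴`, nothing lifts the infrared
cutoff, nothing is about Bałaban's programme.
-/

noncomputable section

open Matrix Complex Finset
open scoped ComplexConjugate

namespace Literature.MathematicalPhysics.QuantumFieldTheory.MagnenRivasseauSeneor1993

namespace Adjoint

open TruncatedGauge Su2Conventions MainStatement Counterterms

/-! ## §1 Coordinates on the printed basis `t_a = iσ_a/2` -/

/-- The `su(2) ⊗ ℂ = sl(2, ℂ)` matrix with COMPLEX components `v` on the printed basis: `Σ_a v_a t_a` (the tree's
`Su2Conventions.toSu2` is the real case; complex components are what the Fourier coefficients `Ã^a_μ(p)` of a real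
field are). [cite: MagnenRivasseauSeneor1993, §II.A p.328 tl.24–29] -/
def toSu2C (v : Fin 3 → ℂ) : Matrix (Fin 2) (Fin 2) ℂ := ∑ a, v a • tgen a

/-- On real components `toSu2C` is the tree's `toSu2`. [cite: MagnenRivasseauSeneor1993, §II.A p.328 tl.24–26] -/
theorem toSu2C_ofReal (X : Fin 3 → ℝ) : toSu2C (fun a => (X a : ℂ)) = toSu2 X := rfl

/-- `Σ_a v_a t_a` written out. [cite: MagnenRivasseauSeneor1993, §II.A p.328 tl.24–29] -/
theorem toSu2C_eq (v : Fin 3 → ℂ) :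
    toSu2C v = (I / 2) • !![v 2, v 0 - I * v 1; v 0 + I * v 1, -v 2] := by
  ext i j; fin_cases i <;> fin_cases j <;>
    simp [toSu2C, tgen, pauli, Fin.sum_univ_three, Matrix.sum_apply] <;> ring

/-- `toSu2C` is additive. [cite: MagnenRivasseauSeneor1993, §II.A p.328 tl.24–26] -/
theorem toSu2C_add (v w : Fin 3 → ℂ) : toSu2C (v + w) = toSu2C v + toSu2C w := by
  simp [toSu2C, Finset.sum_add_distrib, add_smul]

/-- `toSu2C` is `ℂ`-homogeneous. [cite: MagnenRivasseauSeneor1993, §II.A p.328 tl.24–26] -/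
theorem toSu2C_smul (c : ℂ) (v : Fin 3 → ℂ) : toSu2C (c • v) = c • toSu2C v := by
  simp [toSu2C, Finset.smul_sum, smul_smul]

/-- `Σ_a v_a t_a` is traceless. [cite: MagnenRivasseauSeneor1993, §II.A p.328 tl.24–29] -/
theorem trace_toSu2C (v : Fin 3 → ℂ) : (toSu2C v).trace = 0 := by
  rw [toSu2C_eq]
  simp [Matrix.trace_fin_two]

/-- A basis vector goes to the generator: `toSu2C e_b = t_b`. [cite: MagnenRivasseauSeneor1993, §II.A p.328 tl.24–29] -/
theorem toSu2C_single (b : Fin 3) : toSu2C (Pi.single b 1) = tgen b := by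
  unfold toSu2C
  rw [Finset.sum_eq_single b (fun a _ hab => by simp [hab]) (by simp)]
  simp

/-- The generators are traceless. [cite: MagnenRivasseauSeneor1993, §II.A p.328 tl.24–29] -/
theorem trace_tgen (b : Fin 3) : (tgen b).trace = 0 := by
  rw [← toSu2C_single]; exact trace_toSu2C _

/-- The COORDINATES of a `2 × 2` matrix along the printed basis, read off with the printed trace form
«Tr t_a t_b = −δ_ab/2»: `X^a = −2 Tr(t_a X)`. [cite: MagnenRivasseauSeneor1993, §II.A p.328 tl.28–29] -/
def coord (M : Matrix (Fin 2) (Fin 2) ℂ) (a : Fin 3) : ℂ := -2 * Matrix.trace (tgen a * M)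

/-- `Tr(t_a Σ_b v_b t_b) = −v_a/2`. [cite: MagnenRivasseauSeneor1993, §II.A p.328 tl.28–29] -/
theorem trace_tgen_mul_toSu2C (a : Fin 3) (v : Fin 3 → ℂ) : Matrix.trace (tgen a * toSu2C v) = -(1 / 2) * v a := by
  unfold toSu2C
  rw [Finset.mul_sum, Matrix.trace_sum]
  simp_rw [Matrix.mul_smul, Matrix.trace_smul, trace_tgen_mul, smul_eq_mul]
  simp [Fin.sum_univ_three]
  fin_cases a <;> simp <;> ring

/-- The coordinates of `Σ_b v_b t_b` are the `v_a`. [cite: MagnenRivasseauSeneor1993, §II.A p.328 tl.24–29] -/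
theorem coord_toSu2C (v : Fin 3 → ℂ) (a : Fin 3) : coord (toSu2C v) a = v a := by
  unfold coord
  rw [trace_tgen_mul_toSu2C]
  ring

/-- … in particular of the tree's `toSu2 X`. [cite: MagnenRivasseauSeneor1993, §II.A p.328 tl.24–29] -/
theorem coord_toSu2 (X : Fin 3 → ℝ) (a : Fin 3) : coord (toSu2 X) a = X a := by
  rw [← toSu2C_ofReal, coord_toSu2C]

/-- The `t_a` are linearly independent over `ℂ`: `Σ_a v_a t_a` determines `v`. [cite: MagnenRivasseauSeneor1993, §II.A p.328 tl.24–29] -/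
theorem toSu2C_injective : Function.Injective toSu2C := fun v w h => funext fun a => by
  rw [← coord_toSu2C v a, h, coord_toSu2C]

/-- The closed forms of the three coordinates. [cite: MagnenRivasseauSeneor1993, §II.A p.328 tl.26–29] -/
theorem coord_apply (M : Matrix (Fin 2) (Fin 2) ℂ) :
    coord M 0 = -I * (M 1 0 + M 0 1) ∧ coord M 1 = M 0 1 - M 1 0 ∧ coord M 2 = -I * (M 0 0 - M 1 1) := by
  simp only [coord, Matrix.trace_fin_two, Matrix.mul_apply, Fin.sum_univ_two]
  refine ⟨?_, ?_, ?_⟩ <;> (simp [tgen, pauli]; try (ring_nf; try (simp only [Complex.I_sq]; ring_nf)))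

/-- The `t_a` SPAN the traceless matrices (`sl(2, ℂ)`): a traceless `M` is `Σ_a (−2Tr(t_a M)) t_a`.
[cite: MagnenRivasseauSeneor1993, §II.A p.328 tl.24–29] -/
theorem toSu2C_coord (M : Matrix (Fin 2) (Fin 2) ℂ) (htr : M.trace = 0) : toSu2C (coord M) = M := by
  have h00 : M 0 0 + M 1 1 = 0 := by simpa [Matrix.trace_fin_two] using htr
  have h11 : M 1 1 = -M 0 0 := by linear_combination h00
  obtain ⟨h0, h1, h2⟩ := coord_apply M
  rw [toSu2C_eq, h0, h1, h2]
  ext i j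
  fin_cases i <;> fin_cases j <;> simp [h11] <;> ring_nf <;> simp only [Complex.I_sq] <;> ring

/-- For an ANTI-HERMITIAN `M` (the compact real form `su(2)`, where the printed `A_μ` live) the coordinates are REAL.
[cite: MagnenRivasseauSeneor1993, §II.A p.328 tl.24–29] -/
theorem coord_im_of_conjTranspose (M : Matrix (Fin 2) (Fin 2) ℂ) (hM : Mᴴ = -M) (a : Fin 3) : (coord M a).im = 0 := by
  obtain ⟨h0, h1, h2⟩ := coord_apply M
  have e00 := congrFun (congrFun hM 0) 0
  have e01 := congrFun (congrFun hM 0) 1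
  have e11 := congrFun (congrFun hM 1) 1
  simp only [Matrix.conjTranspose_apply, Matrix.neg_apply] at e00 e01 e11
  have r00 : (M 0 0).re = 0 := by have := congrArg Complex.re e00; simp at this; linarith
  have r11 : (M 1 1).re = 0 := by have := congrArg Complex.re e11; simp at this; linarith
  have r01 : (M 0 1).re = -(M 1 0).re := by have := congrArg Complex.re e01; simp at this; linarith
  have i01 : (M 0 1).im = (M 1 0).im := by have := congrArg Complex.im e01; simp at this; linarith
  fin_cases a
  · show (coord M 0).im = 0
    rw [h0]; simp [Complex.mul_im, r01]
  · show (coord M 1).im = 0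
    rw [h1]; simp [i01]
  · show (coord M 2).im = 0
    rw [h2]; simp [Complex.mul_im, r00, r11]

/-- The printed trace form on complex components: `Tr((Σ v_a t_a)(Σ w_b t_b)) = −½ Σ_a v_a w_a`.
[cite: MagnenRivasseauSeneor1993, §II.A p.328 tl.28–29, tl.37–41] -/
theorem trace_toSu2C_mul_toSu2C (v w : Fin 3 → ℂ) :
    Matrix.trace (toSu2C v * toSu2C w) = -(1 / 2) * ∑ a, v a * w a := by
  conv_lhs => rw [toSu2C]
  rw [Finset.sum_mul, Matrix.trace_sum]
  simp_rw [Matrix.smul_mul, Matrix.trace_smul, trace_tgen_mul_toSu2C, smul_eq_mul, Finset.mul_sum]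
  exact Finset.sum_congr rfl fun a _ => by ring

/-- The printed wedge product on complex components: `[Σ v_a t_a, Σ w_b t_b] = −Σ_c (v ×₃ w)_c t_c` — the sign
precision of `Su2Conventions.toSu2_commutator` (printed `t_a = iσ_a/2`), now over `ℂ`.
[cite: MagnenRivasseauSeneor1993, §II.A p.328 tl.32–33] -/
theorem toSu2C_commutator (v w : Fin 3 → ℂ) :
    toSu2C v * toSu2C w - toSu2C w * toSu2C v = -toSu2C (v ⨯₃ w) := by
  rw [toSu2C_eq, toSu2C_eq, toSu2C_eq]
  ext i j; fin_cases i <;> fin_cases j <;>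
    simp [cross_apply] <;> ring_nf <;> simp only [Complex.I_sq, Complex.I_pow_three] <;> ring

/-! ## §2 The adjoint matrix `Ad(g)_ab = −2Tr(t_a g t_b g⁻¹)` -/

/-- THE ADJOINT MATRIX of an invertible `g ∈ M₂(ℂ)` on the printed basis: `Ad(g)_ab = −2 Tr(t_a g t_b g⁻¹)`, the
`a`-th coordinate of `g t_b g⁻¹`. [cite: MagnenRivasseauSeneor1993, (II.4) p.329 tl.4–5, §II.A p.328 tl.24–29] -/
def adC (g : Matrix (Fin 2) (Fin 2) ℂ) : Matrix (Fin 3) (Fin 3) ℂ := Matrix.of fun a b => coord (g * tgen b * g⁻¹) a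

/-- Entry formula. [cite: MagnenRivasseauSeneor1993, (II.4) p.329 tl.4–5] -/
theorem adC_apply (g : Matrix (Fin 2) (Fin 2) ℂ) (a b : Fin 3) : adC g a b = -2 * Matrix.trace (tgen a * (g * tgen b * g⁻¹)) := rfl

/-- `g t_b g⁻¹ = Σ_a Ad(g)_ab t_a` (conjugation keeps the trace zero, and the `t_a` span the traceless matrices).
[cite: MagnenRivasseauSeneor1993, (II.4) p.329 tl.4–5, §II.A p.328 tl.24–29] -/
theorem conj_tgen {g : Matrix (Fin 2) (Fin 2) ℂ} (hg : IsUnit g.det) (b : Fin 3) :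
    g * tgen b * g⁻¹ = toSu2C (fun a => adC g a b) := by
  have htr : (g * tgen b * g⁻¹).trace = 0 := by
    rw [Matrix.trace_mul_cycle, Matrix.nonsing_inv_mul _ hg, Matrix.one_mul, trace_tgen]
  exact (toSu2C_coord _ htr).symm

/-- **(II.4) WITH `∂_μ g = 0` ON COMPONENTS: `g (Σ_b v_b t_b) g⁻¹ = Σ_a (Ad(g) v)_a t_a`** — conjugation by a constant
`g` acts on the (complex) colour components by the matrix `Ad(g)`. [cite: MagnenRivasseauSeneor1993, (II.4) p.329 tl.4–5] -/
theorem conj_toSu2C {g : Matrix (Fin 2) (Fin 2) ℂ} (hg : IsUnit g.det) (v : Fin 3 → ℂ) :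
    g * toSu2C v * g⁻¹ = toSu2C (adC g *ᵥ v) := by
  calc g * toSu2C v * g⁻¹ = ∑ b, v b • (g * tgen b * g⁻¹) := by
        simp [toSu2C, Finset.mul_sum, Finset.sum_mul]
    _ = ∑ b, v b • toSu2C (fun a => adC g a b) := by simp_rw [conj_tgen hg]
    _ = toSu2C (adC g *ᵥ v) := by
        unfold toSu2C
        simp_rw [Finset.smul_sum, smul_smul]
        rw [Finset.sum_comm]
        refine Finset.sum_congr rfl fun a _ => ?_
        rw [← Finset.sum_smul]
        congr 1
        simp only [Matrix.mulVec, dotProduct]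
        exact Finset.sum_congr rfl fun b _ => mul_comm _ _

/-- `Ad(1) = 1`. [cite: MagnenRivasseauSeneor1993, (II.4) p.329 tl.4–5] -/
theorem adC_one : adC (1 : Matrix (Fin 2) (Fin 2) ℂ) = 1 := by
  ext a b
  rw [adC_apply, Matrix.one_mul, inv_one, Matrix.mul_one, ← toSu2C_single b, trace_tgen_mul_toSu2C, Matrix.one_apply,
    Pi.single_apply]
  split_ifs <;> ring

/-- **`Ad` IS A REPRESENTATION**: `Ad(gh) = Ad(g)Ad(h)` for invertible `g, h`. [cite: MagnenRivasseauSeneor1993, (II.4) p.329 tl.4–5] -/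
theorem adC_mul {g h : Matrix (Fin 2) (Fin 2) ℂ} (hg : IsUnit g.det) (hh : IsUnit h.det) : adC (g * h) = adC g * adC h := by
  have hgh : IsUnit (g * h).det := by rw [Matrix.det_mul]; exact hg.mul hh
  have key : ∀ b, (fun a => adC (g * h) a b) = adC g *ᵥ fun a => adC h a b := by
    intro b
    apply toSu2C_injective
    rw [← conj_tgen hgh, ← conj_toSu2C hg, ← conj_tgen hh, Matrix.mul_inv_rev]
    simp only [Matrix.mul_assoc]
  ext a b
  have := congrFun (key b) a
  simp only [Matrix.mulVec, dotProduct] at this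
  rw [this, Matrix.mul_apply]

/-- **ORTHOGONALITY FROM TRACE INVARIANCE**: `Ad(g)ᵀ Ad(g) = 1` for every invertible `g` — because
`Tr(g t_b g⁻¹ · g t_c g⁻¹) = Tr(t_b t_c) = −δ_bc/2`. [cite: MagnenRivasseauSeneor1993, (II.4) p.329 tl.4–5, §II.A p.328 tl.28–29] -/
theorem adC_transpose_mul_self {g : Matrix (Fin 2) (Fin 2) ℂ} (hg : IsUnit g.det) : (adC g)ᵀ * adC g = 1 := by
  ext b c
  have h1 : Matrix.trace ((g * tgen b * g⁻¹) * (g * tgen c * g⁻¹)) = Matrix.trace (tgen b * tgen c) := by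
    rw [show (g * tgen b * g⁻¹) * (g * tgen c * g⁻¹) = g * (tgen b * tgen c) * g⁻¹ by
      rw [Matrix.mul_assoc (g * tgen b), ← Matrix.mul_assoc g⁻¹, ← Matrix.mul_assoc g⁻¹, Matrix.nonsing_inv_mul _ hg,
        Matrix.one_mul, ← Matrix.mul_assoc, Matrix.mul_assoc g]]
    rw [Matrix.trace_mul_cycle, Matrix.nonsing_inv_mul _ hg, Matrix.one_mul]
  rw [conj_tgen hg b, conj_tgen hg c, trace_toSu2C_mul_toSu2C, trace_tgen_mul] at h1
  simp only [Matrix.mul_apply, Matrix.transpose_apply, Matrix.one_apply]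
  split_ifs at h1 ⊢ with hbc
  · linear_combination (-2) * h1
  · linear_combination (-2) * h1

/-- … and `Ad(g) Ad(g)ᵀ = 1`. [cite: MagnenRivasseauSeneor1993, (II.4) p.329 tl.4–5] -/
theorem adC_mul_transpose_self {g : Matrix (Fin 2) (Fin 2) ℂ} (hg : IsUnit g.det) : adC g * (adC g)ᵀ = 1 :=
  mul_eq_one_comm.mp (adC_transpose_mul_self hg)

/-- **`Ad(g)` ACTS BY AUTOMORPHISMS OF THE WEDGE PRODUCT**: `Ad(g)(v ×₃ w) = Ad(g)v ×₃ Ad(g)w` — because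
`g[X, Y]g⁻¹ = [gXg⁻¹, gYg⁻¹]` and the commutator of `su(2)` IS the printed wedge product.
[cite: MagnenRivasseauSeneor1993, §II.A p.328 tl.32–33, (II.4) p.329 tl.4–5] -/
theorem adC_mulVec_cross {g : Matrix (Fin 2) (Fin 2) ℂ} (hg : IsUnit g.det) (v w : Fin 3 → ℂ) :
    adC g *ᵥ (v ⨯₃ w) = (adC g *ᵥ v) ⨯₃ (adC g *ᵥ w) := by
  apply toSu2C_injective
  have hneg : ∀ u : Fin 3 → ℂ, toSu2C (-u) = -toSu2C u := fun u => by
    rw [show -u = (-1 : ℂ) • u by simp, toSu2C_smul]; simp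
  have h2 : g * (toSu2C v * toSu2C w - toSu2C w * toSu2C v) * g⁻¹ =
      (g * toSu2C v * g⁻¹) * (g * toSu2C w * g⁻¹) - (g * toSu2C w * g⁻¹) * (g * toSu2C v * g⁻¹) := by
    have hmid : ∀ X Y : Matrix (Fin 2) (Fin 2) ℂ, (g * X * g⁻¹) * (g * Y * g⁻¹) = g * (X * Y) * g⁻¹ := by
      intro X Y
      rw [Matrix.mul_assoc (g * X), ← Matrix.mul_assoc g⁻¹, ← Matrix.mul_assoc g⁻¹, Matrix.nonsing_inv_mul _ hg,
        Matrix.one_mul, ← Matrix.mul_assoc, Matrix.mul_assoc g]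
    rw [hmid, hmid, Matrix.mul_sub, Matrix.sub_mul]
  have h3 := congrArg (fun M => g * M * g⁻¹) (toSu2C_commutator v w)
  rw [h2, conj_toSu2C hg v, conj_toSu2C hg w, toSu2C_commutator, Matrix.mul_neg, Matrix.neg_mul, conj_toSu2C hg] at h3
  -- h3 : -toSu2C (Ad v ×₃ Ad w) = -toSu2C (Ad (v ×₃ w))
  have := neg_injective h3
  exact this.symm

/-- **`det Ad(g) = 1`** for every invertible `g` — pure algebra, no connectedness: the columns `c_b = Ad(g)e_b` are
orthonormal for the bilinear form and `c_1 ×₃ c_2 = Ad(g)(e_1 ×₃ e_2) = c_0`, so `det = c_0·(c_1 ×₃ c_2) = c_0·c_0 = 1`.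
[cite: MagnenRivasseauSeneor1993, (II.4) p.329 tl.4–5, §II.A p.328 tl.28–33] -/
theorem det_adC {g : Matrix (Fin 2) (Fin 2) ℂ} (hg : IsUnit g.det) : (adC g).det = 1 := by
  set R := adC g with hR
  have hcol : ∀ b : Fin 3, R *ᵥ Pi.single b 1 = fun a => R a b := fun b => by
    ext a; simp [Matrix.mulVec, dotProduct, Pi.single_apply]
  have e12 : (Pi.single 1 1 : Fin 3 → ℂ) ⨯₃ Pi.single 2 1 = Pi.single 0 1 := by
    ext a; fin_cases a <;> simp [cross_apply]
  have hx : (fun a => R a 1) ⨯₃ (fun a => R a 2) = fun a => R a 0 := by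
    rw [← hcol 1, ← hcol 2, ← adC_mulVec_cross hg, e12, hcol 0]
  have horth : ∑ a, R a 0 * R a 0 = 1 := by
    have := congrFun (congrFun (adC_transpose_mul_self hg) 0) 0
    simpa [Matrix.mul_apply] using this
  have hdet : R.det = ∑ a, R a 0 * ((fun a => R a 1) ⨯₃ (fun a => R a 2)) a := by
    rw [Matrix.det_fin_three]
    simp [cross_apply, Fin.sum_univ_three]
    ring
  rw [hdet, hx]
  exact horth

/-! ## §3 Unitary `g`: `Ad(g)` is REAL and lies in `SO(3)` -/

/-- For UNITARY `g` (in particular `g ∈ SU(2)`) the entries `−2Tr(t_a g t_b g⁻¹)` are REAL (`g t_b g⁻¹` is again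
anti-Hermitian). [cite: MagnenRivasseauSeneor1993, (II.4) p.329 tl.4–5, §II.A p.328 tl.24–29] -/
theorem adC_im {g : Matrix (Fin 2) (Fin 2) ℂ} (hg : g ∈ Matrix.unitaryGroup (Fin 2) ℂ) (a b : Fin 3) : (adC g a b).im = 0 := by
  have hu : g * gᴴ = 1 := by
    have := Matrix.mem_unitaryGroup_iff.mp hg
    simpa [Matrix.star_eq_conjTranspose] using this
  have hinv : g⁻¹ = gᴴ := Matrix.inv_eq_right_inv hu
  have ht : (tgen b)ᴴ = -tgen b := by
    rw [tgen, Matrix.conjTranspose_smul, pauli_conjTranspose]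
    simp [div_eq_mul_inv, neg_smul]
  have hskew : (g * tgen b * g⁻¹)ᴴ = -(g * tgen b * g⁻¹) := by
    rw [hinv, Matrix.conjTranspose_mul, Matrix.conjTranspose_mul, Matrix.conjTranspose_conjTranspose, ht]
    simp [Matrix.mul_assoc]
  exact coord_im_of_conjTranspose _ hskew a

/-- THE REAL ADJOINT MATRIX `Ad(g) ∈ M₃(ℝ)` (real parts of the entries; equal to them for unitary `g`).
[cite: MagnenRivasseauSeneor1993, (II.4) p.329 tl.4–5] -/
def ad (g : Matrix (Fin 2) (Fin 2) ℂ) : Matrix (Fin 3) (Fin 3) ℝ := Matrix.of fun a b => (adC g a b).re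

/-- For unitary `g`: `Ad(g)_ab` (complex) `=` its real part. [cite: MagnenRivasseauSeneor1993, (II.4) p.329 tl.4–5] -/
theorem ofReal_ad {g : Matrix (Fin 2) (Fin 2) ℂ} (hg : g ∈ Matrix.unitaryGroup (Fin 2) ℂ) (a b : Fin 3) :
    ((ad g a b : ℝ) : ℂ) = adC g a b := by
  apply Complex.ext <;> simp [ad, adC_im hg]

/-- Matrix form: `adC g = (ad g)` mapped into `ℂ`. [cite: MagnenRivasseauSeneor1993, (II.4) p.329 tl.4–5] -/
theorem adC_eq_map {g : Matrix (Fin 2) (Fin 2) ℂ} (hg : g ∈ Matrix.unitaryGroup (Fin 2) ℂ) :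
    adC g = Complex.ofRealHom.mapMatrix (ad g) := by
  ext a b
  simp [RingHom.mapMatrix_apply, Matrix.map_apply, ofReal_ad hg]

/-- A unitary matrix has invertible determinant (plumbing for the real-matrix transfer). [folklore] -/
private theorem isUnit_det_of_mem {g : Matrix (Fin 2) (Fin 2) ℂ} (hg : g ∈ Matrix.unitaryGroup (Fin 2) ℂ) : IsUnit g.det := by
  have hu : g * gᴴ = 1 := by
    have := Matrix.mem_unitaryGroup_iff.mp hg
    simpa [Matrix.star_eq_conjTranspose] using this
  exact Matrix.isUnit_det_of_right_inverse hu

/-- **`Ad(g)ᵀ Ad(g) = 1` in `M₃(ℝ)`** for unitary `g`. [cite: MagnenRivasseauSeneor1993, (II.4) p.329 tl.4–5, §III p.347 tl.19–22] -/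
theorem ad_transpose_mul_self {g : Matrix (Fin 2) (Fin 2) ℂ} (hg : g ∈ Matrix.unitaryGroup (Fin 2) ℂ) : (ad g)ᵀ * ad g = 1 := by
  ext b c
  have h := congrFun (congrFun (adC_transpose_mul_self (isUnit_det_of_mem hg)) b) c
  simp only [Matrix.mul_apply, Matrix.transpose_apply, ← ofReal_ad hg, Matrix.one_apply] at h ⊢
  split_ifs at h ⊢ <;> exact_mod_cast h

/-- **`det Ad(g) = 1` in `ℝ`** for unitary `g`. [cite: MagnenRivasseauSeneor1993, (II.4) p.329 tl.4–5, §III p.347 tl.19–22] -/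
theorem det_ad {g : Matrix (Fin 2) (Fin 2) ℂ} (hg : g ∈ Matrix.unitaryGroup (Fin 2) ℂ) : (ad g).det = 1 := by
  have h1 : Complex.ofRealHom (ad g).det = (adC g).det := by rw [RingHom.map_det, adC_eq_map hg]
  have h2 : ((ad g).det : ℂ) = 1 := by rw [← det_adC (isUnit_det_of_mem hg), ← h1]; rfl
  exact_mod_cast h2

/-- **`Ad(g) ∈ SO(3)` FOR EVERY UNITARY `g ∈ M₂(ℂ)`, IN PARTICULAR FOR `g ∈ SU(2)`** — the statement gen 5's
`MRS93CountertermFunctional` §4 and gen 8's `MRS93FiniteGaugeTransformations` invoke in prose («for R ∈ SO(3) the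
adjoint action of a constant g ∈ SU(2)»), now a theorem. [cite: MagnenRivasseauSeneor1993, (II.4) p.329 tl.4–5, §III p.347 tl.19–22] -/
theorem ad_mem_specialOrthogonalGroup {g : Matrix (Fin 2) (Fin 2) ℂ} (hg : g ∈ Matrix.unitaryGroup (Fin 2) ℂ) :
    ad g ∈ Matrix.specialOrthogonalGroup (Fin 3) ℝ := by
  rw [Matrix.mem_specialOrthogonalGroup_iff, Matrix.mem_orthogonalGroup_iff']
  refine ⟨?_, det_ad hg⟩
  simpa [Matrix.star_eq_conjTranspose] using ad_transpose_mul_self hg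

/-- … so for `g` in Mathlib's `Matrix.specialUnitaryGroup (Fin 2) ℂ = SU(2)`. [cite: MagnenRivasseauSeneor1993, (II.4) p.329 tl.4–5, §III p.347 tl.19–22] -/
theorem ad_mem_specialOrthogonalGroup_of_mem_specialUnitaryGroup {g : Matrix (Fin 2) (Fin 2) ℂ}
    (hg : g ∈ Matrix.specialUnitaryGroup (Fin 2) ℂ) : ad g ∈ Matrix.specialOrthogonalGroup (Fin 3) ℝ :=
  ad_mem_specialOrthogonalGroup (Matrix.mem_specialUnitaryGroup_iff.mp hg).1

/-- `Ad(1) = 1` in `M₃(ℝ)`. [cite: MagnenRivasseauSeneor1993, (II.4) p.329 tl.4–5] -/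
theorem ad_one : ad (1 : Matrix (Fin 2) (Fin 2) ℂ) = 1 := by
  ext a b
  simp only [ad, Matrix.of_apply, adC_one, Matrix.one_apply]
  split_ifs <;> simp

/-- `Ad(gh) = Ad(g)Ad(h)` in `M₃(ℝ)` for unitary `g, h`: a homomorphism `U(2) → SO(3)`.
[cite: MagnenRivasseauSeneor1993, (II.4) p.329 tl.4–5] -/
theorem ad_mul {g h : Matrix (Fin 2) (Fin 2) ℂ} (hg : g ∈ Matrix.unitaryGroup (Fin 2) ℂ)
    (hh : h ∈ Matrix.unitaryGroup (Fin 2) ℂ) : ad (g * h) = ad g * ad h := by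
  have hgh : g * h ∈ Matrix.unitaryGroup (Fin 2) ℂ := mul_mem hg hh
  ext a b
  have e := congrFun (congrFun (adC_mul (isUnit_det_of_mem hg) (isUnit_det_of_mem hh)) a) b
  rw [Matrix.mul_apply] at e
  simp only [← ofReal_ad hg, ← ofReal_ad hh, ← ofReal_ad hgh] at e
  rw [Matrix.mul_apply]
  exact_mod_cast e

/-! ## §4 The dictionary to the tree's colour rotations and the printed invariance statements over `SU(2)` itself -/

/-- Gen 5's `rotVec (Ad g)` IS multiplication by the complex adjoint matrix. [cite: MagnenRivasseauSeneor1993, (II.4) p.329 tl.4–5, §III p.347 tl.19–22] -/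
theorem rotVec_ad {g : Matrix (Fin 2) (Fin 2) ℂ} (hg : g ∈ Matrix.unitaryGroup (Fin 2) ℂ) (v : Fin 3 → ℂ) :
    rotVec (ad g) v = adC g *ᵥ v := by
  ext a
  simp [rotVec, Matrix.mulVec, dotProduct, ofReal_ad hg]

/-- **(II.4) FOR CONSTANT `g`, ON COMPLEX COLOUR VECTORS, IN THE TREE'S VOCABULARY**: `g (Σ_a v_a t_a) g⁻¹ = Σ_a (R·v)_a t_a`
with `R = Ad(g)` and gen 5's `rotVec`. [cite: MagnenRivasseauSeneor1993, (II.4) p.329 tl.4–5] -/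
theorem conj_toSu2C_eq_rotVec {g : Matrix (Fin 2) (Fin 2) ℂ} (hg : g ∈ Matrix.unitaryGroup (Fin 2) ℂ) (v : Fin 3 → ℂ) :
    g * toSu2C v * g⁻¹ = toSu2C (rotVec (ad g) v) := by
  rw [rotVec_ad hg, conj_toSu2C (isUnit_det_of_mem hg)]

/-- **(II.4) FOR CONSTANT `g` AS PRINTED, on `A_μ = Σ_a A^a_μ t_a` with REAL components**: `g A_μ g⁻¹ = Σ_a (Ad(g)A_μ)^a t_a`.
[cite: MagnenRivasseauSeneor1993, (II.4) p.329 tl.4–5, §II.A p.328 tl.24–26] -/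
theorem conj_toSu2 {g : Matrix (Fin 2) (Fin 2) ℂ} (hg : g ∈ Matrix.unitaryGroup (Fin 2) ℂ) (X : Fin 3 → ℝ) :
    g * toSu2 X * g⁻¹ = toSu2 (ad g *ᵥ X) := by
  rw [← toSu2C_ofReal, ← toSu2C_ofReal, conj_toSu2C (isUnit_det_of_mem hg)]
  congr 1
  ext a
  simp [Matrix.mulVec, dotProduct, ← ofReal_ad hg]

/-- **THE TREE'S `colourRotate (Ad g)` IS (II.4) WITH `∂_μ g = 0`**: on every Fourier coefficient, the su(2) matrix of the
rotated configuration is the conjugate by `g` of that of `A`: `Σ_a (R·A)~^a_μ(p) t_a = g (Σ_a Ã^a_μ(p) t_a) g⁻¹`, `R = Ad(g)`.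
[cite: MagnenRivasseauSeneor1993, (II.4) p.329 tl.4–5, §III p.347 tl.19–22] -/
theorem toSu2C_coeff_colourRotate_ad {g : Matrix (Fin 2) (Fin 2) ℂ} (hg : g ∈ Matrix.unitaryGroup (Fin 2) ℂ)
    (A : Config) (p : Momentum) (μ : Fin 4) :
    toSu2C (fun a => coeff (colourRotate (ad g) A) p μ a) = g * toSu2C (fun a => coeff A p μ a) * g⁻¹ := by
  rw [coeff_colourRotate_vec, conj_toSu2C_eq_rotVec hg]

variable (S : Finset Momentum)

/-- **«This action is invariant under the gauge transformations» (p.329 tl.4) FOR THE CONSTANT ONES, QUANTIFIED OVER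
`g` ITSELF**: the cut-off Yang–Mills action (II.2) of `…AxialYMAction` is invariant under `A ↦ gAg⁻¹` for every unitary
`g` (gen 5's `action_colourRotate` at `R = Ad(g) ∈ SO(3)`). [cite: MagnenRivasseauSeneor1993, (II.2)–(II.4) pp.328–329] -/
theorem action_colourRotate_ad {g : Matrix (Fin 2) (Fin 2) ℂ} (hg : g ∈ Matrix.unitaryGroup (Fin 2) ℂ) (lam : ℝ)
    (A : Config) : action S lam (colourRotate (ad g) A) = action S lam A :=
  action_colourRotate S (ad_transpose_mul_self hg) (det_ad hg) lam A

/-- **«Our ultraviolet cutoff does not break global SU(2) … invariance» (p.347 tl.19–22), QUANTIFIED OVER `SU(2) ⊆ U(2)`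
ITSELF**: the counterterm functional `CT_ρ` of (III.1) and the factor `e^{CT_ρ}` of (II.78) are invariant under
`A ↦ gAg⁻¹` for every unitary `g` (gen 5's theorems at `R = Ad(g)`). [cite: MagnenRivasseauSeneor1993, §III (III.1) p.347, p.347 tl.19–22] -/
theorem counterterm_colourRotate_ad {g : Matrix (Fin 2) (Fin 2) ℂ} (hg : g ∈ Matrix.unitaryGroup (Fin 2) ℂ)
    (cf : CountertermFamily) (ρ : ℕ) (A : Config) :
    counterterm S cf ρ (colourRotate (ad g) A) = counterterm S cf ρ A ∧
      ctFactor S cf ρ (colourRotate (ad g) A) = ctFactor S cf ρ A :=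
  ⟨counterterm_colourRotate S (ad_transpose_mul_self hg) (det_ad hg) cf ρ A,
    ctFactor_colourRotate_of_mem_specialOrthogonalGroup S (ad_mem_specialOrthogonalGroup hg) cf ρ A⟩

/-- The four NEW operators of (III.1) one by one, over unitary `g`. [cite: MagnenRivasseauSeneor1993, §III (III.1) p.347, p.347 tl.19–22] -/
theorem ops_colourRotate_ad {g : Matrix (Fin 2) (Fin 2) ℂ} (hg : g ∈ Matrix.unitaryGroup (Fin 2) ℂ) (A : Config) :
    opA2 S (colourRotate (ad g) A) = opA2 S A ∧ opALapA S (colourRotate (ad g) A) = opALapA S A ∧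
      opDivSq S (colourRotate (ad g) A) = opDivSq S A ∧ opA4 S (colourRotate (ad g) A) = opA4 S A :=
  ops_invariant_of_mem_specialOrthogonalGroup S (ad_mem_specialOrthogonalGroup hg) A

end Adjoint

end Literature.MathematicalPhysics.QuantumFieldTheory.MagnenRivasseauSeneor1993
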